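import Literature.Computability.AlgebraicComplexity.LaserValueCertificate
import Literature.Computability.AlgebraicComplexity.BigCwFourthOmega
import HarnessLib

/-!
# A proved `CW_5` degeneration certificate: `CW5DegenerationCertificate [(1, 2.37295)]`
(the classical `CW_5^{⊗4}` analysis, Le Gall 2014 Table 2, `r = 2`, in certificate form)

Topic `Literature/Computability/AlgebraicComplexity`.  The records `ω ≤ 2.371552`
(`vxxz2024_omega_le`, Vassilevska Williams–Xu–Xu–Zhou 2024) and `ω ≤ 2.371339` (Alman–Duan–
Vassilevska Williams–Xu–Xu–Zhou 2025) rest in this tree on ONE unformalised layer, stated through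
the predicate `CW5DegenerationCertificate` of `RectangularExponentLaserCertificate.lean`
(`vxxz2024_omega_le_of_cw5Certificate`, `RectangularExponentCertReduction.lean`): a degeneration of
copies of powers of `CW_5` into independent copies of one matrix multiplication tensor with the
exponent inequality of the papers' limiting condition.  This file exhibits a PROVED inhabitant of
that predicate at the best row the tree proves by the classical laser method — the fourth power of
the Coppersmith–Winograd tensor at `q = 5`, `ρ = 2.37295` (`BigCwFourthOmega.lean`,
`LeGall2014_cw4_omega_le : ω ≤ 2.37295`; Le Gall 2014, Table 2, `r = 2`: `2.3729269`) — by reading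
the Le Gall VALUE produced by that analysis (`exists_hasLaserValue_symm3_bigCwFour`:
`V_ρ(T ⊗ T_C ⊗ T_{C²}) > 7^{12}` for `T = CW_5^{⊗2} ⊗ CW_5^{⊗2}`) through the bridge
`cw5Certificate_of_hasLaserValue` (`LaserValueCertificate.lean`).

* `hasLaserValue_symm3_of_laserMethodSym_cubed` — Le Gall's Thm. 4.1 (`laserMethodSym_hasLaserValue`)
  with the component values in the cubed form of the recursion (the value half of
  `omega_le_of_laserMethodSym_cubed`);
* `exists_hasLaserValue_symm3_bigCwFour` — the `CW_5^{⊗4}` analysis of `BigCwFourthOmega.lean` as a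
  value: some `v > 7^{12}` with `HasLaserValue 2.37295 (symm3 (bigCwFour K 5)) v`;
* `tensorRestrictsTo_cwPow_two_bigCwSq`, `…_four_bigCwFour`, `…_twelve_symm3_bigCwFour` — the
  relabellings `CW_q^{⊗2} ≥ CW_q ⊗ CW_q`, `CW_q^{⊗4} ≥ t^{⊗4}`, `CW_q^{⊗12} ≥ t^{⊗4} ⊗ t^{⊗4}_C ⊗ t^{⊗4}_{C²}`
  (`CW_q` is cyclically symmetric: `rotate_bigCwFour`);
* `cw5Certificate_leGall_cw4` — **`CW5DegenerationCertificate [(1, 2.37295)]`, proved**;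
  `omegaRect_one_one_one_le_cw4` — through the certificate pipeline
  (`omegaRect_le_of_cw5DegenerationCertificate`) it gives back `ω(1,1,1) ≤ 2.37295` over `ℂ`.

Everything is proved; no new definitions; no named facts.

## References

* F. Le Gall, *Powers of tensors and fast matrix multiplication*, ISSAC 2014, arXiv:1401.7714,
  Thm. 2.2, Thm. 4.1, §6.2–6.3, Table 2 (`r = 2`). [LeGall2014]
* J. Alman, R. Duan, V. Vassilevska Williams, Y. Xu, Z. Xu, R. Zhou, SODA 2025, §7 (procedure of
  degeneration = the certificate format). [AlmanDuanVassilevskaWilliamsXuXuZhou2025]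
* V. Vassilevska Williams, Y. Xu, Z. Xu, R. Zhou, SODA 2024, §8. [VassilevskaWilliamsXuXuZhou2024]
-/

noncomputable section

open scoped BigOperators
open Finset

namespace Literature.Computability.AlgebraicComplexity

open Literature.Barriers.MatrixMultiplication

universe u

/-! ## Thm. 4.1 with cubed component values -/

section Value

variable {K : Type u} [Field K]
variable {ι κ μ I J L : Type*} [Fintype ι] [Fintype κ] [Fintype μ] [DecidableEq ι] [DecidableEq κ]
  [DecidableEq μ] [Fintype I] [Fintype J] [Fintype L] [DecidableEq I] [DecidableEq J] [DecidableEq L]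

/-- **Le Gall Thm. 4.1 with the component values in cubed form**: if
`V_ρ(t(s) ⊗ t(s)_C ⊗ t(s)_{C²}) ≥ V(s) > 0` for `s ∈ S` (tight `S ⊇ supp t`), then for every
probability distribution `P` on `S`,
`V_ρ(t ⊗ t_C ⊗ t_{C²}) ≥ 2^{∑_ℓ H(P_ℓ) − 3Γ_S(P)} ∏_{s∈S} V(s)^{P(s)}` (apply
`laserMethodSym_hasLaserValue` to `u = V^{1/3}`). [cite: LeGall2014, Thm. 4.1] -/
theorem hasLaserValue_symm3_of_laserMethodSym_cubed (t : ι → κ → μ → K) (bI : ι → I) (bJ : κ → J)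
    (bL : μ → L) (S : Finset (I × J × L)) (hS : ∀ a b c, t a b c ≠ 0 → (bI a, bJ b, bL c) ∈ S)
    {r b : ℕ} (α : I → Fin r → ℤ) (β : J → Fin r → ℤ) (γ : L → Fin r → ℤ)
    (hα : Function.Injective α) (hβ : Function.Injective β) (hγ : Function.Injective γ)
    (hαb : ∀ i k, |α i k| ≤ b) (hβb : ∀ j k, |β j k| ≤ b) (hγb : ∀ l k, |γ l k| ≤ b)
    (htight : ∀ s ∈ S, ∀ k, α s.1 k + β s.2.1 k + γ s.2.2 k = 0)
    {ρ : ℝ} (V : I × J × L → ℝ) (hV : ∀ s ∈ S, 0 < V s)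
    (hval : ∀ s ∈ S, HasLaserValue ρ
      (symm3 (partSubtensor bI bJ bL t {s.1} {s.2.1} {s.2.2})) (V s))
    (P : I × J × L → ℝ) (hP0 : ∀ s, 0 ≤ P s) (hP1 : ∑ s, P s = 1)
    (hPS : ∀ s, s ∉ S → P s = 0) :
    HasLaserValue ρ (symm3 t) ((2 : ℝ) ^ (shannonEntropy (marginalDist₁ P) +
        shannonEntropy (marginalDist₂ P) + shannonEntropy (marginalDist₃ P) -
        3 * maxEntropyPenalty S P) * ∏ s ∈ S, V s ^ P s) := by
  classical
  set u : I × J × L → ℝ := fun s => V s ^ ((1 : ℝ) / 3) with hu_def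
  have hu : ∀ s ∈ S, 0 < u s := fun s hs => Real.rpow_pos_of_pos (hV s hs) _
  have hu3 : ∀ s ∈ S, u s ^ 3 = V s := fun s hs => by
    rw [hu_def, ← Real.rpow_natCast, ← Real.rpow_mul (hV s hs).le]
    norm_num
  have hprod : (∏ s ∈ S, u s ^ P s) ^ 3 = ∏ s ∈ S, V s ^ P s := by
    rw [← Finset.prod_pow]
    refine Finset.prod_congr rfl fun s hs => ?_
    rw [hu_def, ← Real.rpow_natCast, ← Real.rpow_mul (hV s hs).le, ← Real.rpow_mul (hV s hs).le]
    congr 1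
    push_cast
    ring
  have h := laserMethodSym_hasLaserValue t bI bJ bL S hS α β γ hα hβ hγ hαb hβb hγb htight u hu
    (fun s hs => by rw [hu3 s hs]; exact hval s hs) P hP0 hP1 hPS
  rwa [hprod] at h

end Value

/-! ## The value of `CW_5^{⊗4}` at `ρ = 2.37295` -/

section FourthPower

/-- **The `CW_5^{⊗4}` analysis as a value**: `V_ρ(T ⊗ T_C ⊗ T_{C²}) ≥ v` for some `v > 7^{12}`,
`T = t^{⊗2} ⊗ t^{⊗2}`, `t = CW_5`, `ρ = 2.37295` — the hypotheses of `LeGall2014_cw4_omega_le`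
(product-form distribution `cwP4`, penalty `0`, the 45 component values `hasLaserValue_cw4Comp_all`,
the entropy bounds `cw4_entropy1–3` and the numerical core `12 ln 7 < 3E + W`) fed into Thm. 4.1
instead of Thm. 2.2. [cite: LeGall2014, Table 2 (r = 2) and §6.3] -/
theorem exists_hasLaserValue_symm3_bigCwFour (K : Type u) [Field K] :
    ∃ v : ℝ, (7 : ℝ) ^ 12 < v ∧ HasLaserValue cwRho (symm3 (bigCwFour K 5)) v := by
  have hφ := cwPhi4_pos
  have hne := cwSupport₄_nonempty
  have hP : cwP4 ∈ stdSimplex ℝ (Fin 9 × Fin 9 × Fin 9) := prodFormDist_mem_stdSimplex hφ hφ hφ hne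
  have hPS : ∀ s, s ∉ cwSupport₄ → cwP4 s = 0 := prodFormDist_eq_zero
  have hΓ : maxEntropyPenalty cwSupport₄ cwP4 = 0 := maxEntropyPenalty_prodFormDist hφ hφ hφ hne
  have h := hasLaserValue_symm3_of_laserMethodSym_cubed (bigCwFour K 5) cwLev4 cwLev4 cwLev4
    cwSupport₄ (bigCwFour_cwSupport₄ K 5) cwTight₄ cwTight₄ cwTight₄γ cwTight₄_injective
    cwTight₄_injective cwTight₄γ_injective cwTight₄_bound cwTight₄_bound cwTight₄γ_bound cwTight₄_sum
    (fun s => Real.exp (cwL4 s)) (fun s _ => Real.exp_pos _) (hasLaserValue_cw4Comp_all K) cwP4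
    hP.1 hP.2 hPS
  refine ⟨_, ?_, h⟩
  rw [hΓ, mul_zero, sub_zero, prod_exp_rpow, cw4_sum_values, Real.rpow_def_of_pos two_pos,
    ← Real.exp_add]
  have hH1 := cw4_entropy1
  have hH2 := cw4_entropy2
  have hH3 := cw4_entropy3
  have hcore := cw4_numeric_core
  calc (7 : ℝ) ^ 12 = Real.exp (12 * Real.log 7) := by
        rw [← Real.exp_log (by norm_num : (0 : ℝ) < 7 ^ 12), Real.log_pow]; push_cast; ring_nf
    _ < _ := Real.exp_lt_exp.2 (by linarith)

end FourthPower

/-! ## `CW_q^{⊗12} ≥ T ⊗ T_C ⊗ T_{C²}` for `T = CW_q^{⊗2} ⊗ CW_q^{⊗2}` -/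

section Relabel

variable (K : Type u) [Field K] (q : ℕ)

/-- `CW_q^{⊗2} ≥ CW_q ⊗ CW_q` (`= bigCwSq`). [folklore] -/
theorem tensorRestrictsTo_cwPow_two_bigCwSq :
    TensorRestrictsTo (kroneckerPow (bigCwTensor K q) 2) (bigCwSq K q) :=
  (tensorRestrictsTo_kroneckerPow_add (bigCwTensor K q) 1 1).trans
    ((tensorRestrictsTo_kroneckerPow_one _).kronecker (tensorRestrictsTo_kroneckerPow_one _))

/-- `CW_q^{⊗4} ≥ t^{⊗4} = (CW_q ⊗ CW_q) ⊗ (CW_q ⊗ CW_q)` (`= bigCwFour`). [folklore] -/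
theorem tensorRestrictsTo_cwPow_four_bigCwFour :
    TensorRestrictsTo (kroneckerPow (bigCwTensor K q) 4) (bigCwFour K q) :=
  (tensorRestrictsTo_kroneckerPow_add (bigCwTensor K q) 2 2).trans
    ((tensorRestrictsTo_cwPow_two_bigCwSq K q).kronecker (tensorRestrictsTo_cwPow_two_bigCwSq K q))

/-- **`CW_q^{⊗12} ≥ t^{⊗4} ⊗ t^{⊗4}_C ⊗ t^{⊗4}_{C²}`**: `t^{⊗4}` is invariant under rotation
(`rotate_bigCwFour`), so its Le Gall symmetrisation is `t^{⊗4} ⊗ t^{⊗4} ⊗ t^{⊗4} ≤ CW_q^{⊗12}`.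
[cite: LeGall2014, §6.2 (t^{⊗4} is S₃-invariant)] -/
theorem tensorRestrictsTo_cwPow_twelve_symm3_bigCwFour :
    TensorRestrictsTo (kroneckerPow (bigCwTensor K q) 12) (symm3 (bigCwFour K q)) := by
  have h4 := tensorRestrictsTo_cwPow_four_bigCwFour K q
  have h : TensorRestrictsTo (kroneckerPow (bigCwTensor K q) 12)
      (kroneckerTensor (bigCwFour K q) (kroneckerTensor (bigCwFour K q) (bigCwFour K q))) :=
    (tensorRestrictsTo_kroneckerPow_add (bigCwTensor K q) 4 8).trans
      (h4.kronecker ((tensorRestrictsTo_kroneckerPow_add (bigCwTensor K q) 4 4).trans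
        (h4.kronecker h4)))
  have e : symm3 (bigCwFour K q) =
      kroneckerTensor (bigCwFour K q) (kroneckerTensor (bigCwFour K q) (bigCwFour K q)) := by
    rw [symm3, rotate_bigCwFour, rotate_bigCwFour]
  rw [e]
  exact h

end Relabel

/-! ## The certificate -/

section Certificate

/-- **`CW5DegenerationCertificate [(1, 2.37295)]` — proved.**  The certificate predicate behind the
records `ω ≤ 2.371552` / `ω ≤ 2.371339` (there a named fact for the asymmetric-hashing analyses),
inhabited by the classical laser method on `CW_5^{⊗4}`: for every `δ > 0` some power `CW_5^{⊗N}`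
degenerates into `V` independent copies of `⟨a,a,a⟩`, `a ≥ 2`, with `7^N ≤ V a^{2.37295 + δ}`.
[cite: LeGall2014, Table 2 (r = 2), Thm. 2.2 and Thm. 4.1] [cite: AlmanDuanVassilevskaWilliamsXuXuZhou2025, §7 (procedure of degeneration)] -/
theorem cw5Certificate_leGall_cw4 : CW5DegenerationCertificate [((1 : ℝ), (2.37295 : ℝ))] := by
  obtain ⟨v, hv, h⟩ := exists_hasLaserValue_symm3_bigCwFour ℂ
  have hρ : (0 : ℝ) < 2.37295 := by norm_num
  have h' : HasLaserValue 2.37295 (symm3 (bigCwFour ℂ 5)) v := by simpa only [cwRho] using h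
  exact cw5Certificate_of_hasLaserValue (c := 12) (by norm_num)
    (tensorRestrictsTo_cwPow_twelve_symm3_bigCwFour ℂ 5) hρ h' hv

/-- Through the certificate pipeline (`omegaRect_le_of_cw5DegenerationCertificate`, layers 1–2 of
the VXXZ/ADVXXZ proofs): **`ω(1,1,1) ≤ 2.37295` over `ℂ`**, i.e. `LeGall2014_cw4_omega_le ℂ` again
(`omegaRect_one_one_one`). [cite: LeGall2014, Table 2 (r = 2)] -/
theorem omegaRect_one_one_one_le_cw4 : omegaRect ℂ 1 1 1 ≤ 2.37295 :=
  omegaRect_le_of_cw5DegenerationCertificate cw5Certificate_leGall_cw4 (List.mem_singleton.2 rfl)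
    zero_le_one

end Certificate

end Literature.Computability.AlgebraicComplexity
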